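import Summits.ABC.StewartYu.PadicG3ParOdd
import Summits.ABC.StewartYu.RecordOddMono
import HarnessLib

/-!
# Cell abc-stewartyu, crux `Y07Odd` (stmt-ABC-19658), line `gen3-slab-odd`: the parameter record of the odd-`p` frame, R21 form (route-holder
# rulings R21-b/e, 2026-08-27T04:24Z/04:39Z): `Nq := K = p^m·(p−1)` (the cell invariant `K ≤ Nq ≤ 2ⁿK`), `Amax := min Vmax (2ⁿ·∏V)`

`Summits/ABC/StewartYu/PadicG3ParOdd2.lean` — cell `abc-stewartyu` (seat p2-g4, F-odd lead).  One definition `parOdd₂` and its field lemmas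
(`parOdd₂_Nq_eq_K : P.Nq = P.K`, `parOdd₂_two_le_Nq`, `parOdd₂_Amax_le_Vmax`, `parOdd₂_Amax_le_prod`, rfl lemmas).  No named fact.

References: K. Yu, Acta Math. 211 (2013) §7; cell pages HOME/plan (R21).
-/

noncomputable section

open Finset

namespace Summit.ABC.StewartYu

/-- **The parameter record of the odd-`p` frame (R21 form).** [folklore] -/
def parOdd₂ (p : ℕ) (hp : 3 ≤ p) {n : ℕ} (hn : 1 ≤ n) (V : Fin n → ℝ) (Vmax W : ℝ) (hV1 : ∀ j, 1 ≤ V j) (hVm : ∀ j, V j ≤ Vmax)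
    (hW : 1 ≤ W) : PadicG3Par n where
  p := p
  A := V
  Amax := min Vmax (2 ^ n * ∏ j, V j)
  W := W
  Nq := p ^ ⌈PadicG3Par.cG * (n + 1) / Real.log p - 1 / 2⌉₊ * (p - 1)
  K₀ := p - 1
  θ₀ := 1 / 2
  hn := hn
  hp := by omega
  hA := fun j => le_trans (le_trans (le_of_lt Real.log_two_lt_d9) (by norm_num)) (hV1 j)
  hAmax := fun j => le_min (hVm j) (GenThreeFrameSpecOdd.le_two_pow_mul_prod_of_one_le hV1 j)
  hAmax1 := le_min (le_trans (hV1 ⟨0, hn⟩) (hVm ⟨0, hn⟩)) (le_trans (hV1 ⟨0, hn⟩) (GenThreeFrameSpecOdd.le_two_pow_mul_prod_of_one_le hV1 _))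
  hW := hW
  hNq := Nat.mul_pos (pow_pos (by omega) _) (by omega)
  hK₀ := by omega
  hK₀p := Nat.sub_le p 1
  hθ₀ := by norm_num
  hθ₀2 := by norm_num

namespace parOdd₂

variable (p : ℕ) (hp : 3 ≤ p) {n : ℕ} (hn : 1 ≤ n) (V : Fin n → ℝ) (Vmax W : ℝ) (hV1 : ∀ j, 1 ≤ V j) (hVm : ∀ j, V j ≤ Vmax)
  (hW : 1 ≤ W)

/-- field `p`. [folklore] -/ theorem p_eq : (parOdd₂ p hp hn V Vmax W hV1 hVm hW).p = p := rfl
/-- field `A`. [folklore] -/ theorem A_eq : (parOdd₂ p hp hn V Vmax W hV1 hVm hW).A = V := rfl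
/-- field `W`. [folklore] -/ theorem W_eq : (parOdd₂ p hp hn V Vmax W hV1 hVm hW).W = W := rfl
/-- field `K₀`. [folklore] -/ theorem K₀_eq : (parOdd₂ p hp hn V Vmax W hV1 hVm hW).K₀ = p - 1 := rfl
/-- field `θ₀`. [folklore] -/ theorem θ₀_eq : (parOdd₂ p hp hn V Vmax W hV1 hVm hW).θ₀ = 1 / 2 := rfl
/-- `Amax ≤ Vmax`. [folklore] -/
theorem Amax_le_Vmax : (parOdd₂ p hp hn V Vmax W hV1 hVm hW).Amax ≤ Vmax := min_le_left _ _
/-- `Amax ≤ 2ⁿ·∏V`. [folklore] -/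
theorem Amax_le_prod : (parOdd₂ p hp hn V Vmax W hV1 hVm hW).Amax ≤ 2 ^ n * ∏ j, V j := min_le_right _ _
/-- **`Nq = K`** (R21-b). [folklore] -/
theorem Nq_eq_K : (parOdd₂ p hp hn V Vmax W hV1 hVm hW).Nq = (parOdd₂ p hp hn V Vmax W hV1 hVm hW).K := by
  unfold PadicG3Par.K PadicG3Par.m
  rfl
/-- `2 ≤ Nq`. [folklore] -/
theorem two_le_Nq : 2 ≤ (parOdd₂ p hp hn V Vmax W hV1 hVm hW).Nq := by
  show 2 ≤ p ^ ⌈PadicG3Par.cG * (n + 1) / Real.log p - 1 / 2⌉₊ * (p - 1)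
  calc 2 = 1 * 2 := by ring
    _ ≤ p ^ ⌈PadicG3Par.cG * (n + 1) / Real.log p - 1 / 2⌉₊ * (p - 1) := Nat.mul_le_mul (Nat.one_le_pow _ _ (by omega)) (by omega)

end parOdd₂

end Summit.ABC.StewartYu

end
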